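import Summits.QuantumFields.YangMills.Theorems.ColdStartUniversalityLatticeLangevinLocalCarre
import Summits.QuantumFields.YangMills.Theorems.ColdStartUniversalityLatticeLangevinLocalExtension
import Summits.QuantumFields.YangMills.Theorems.ColdStartUniversalityLatticeLangevinBakryEmeryGradientBound
import Mathlib.Analysis.Calculus.BumpFunction.SmoothApprox
import HarnessLib

/-!
# The POINTWISE `L²` GRADIENT BOUND `|∇P_t F|(x) ≤ e^(−(1−12|β'|)t)·(P_t |∇F|²(x))^{1/2}` (Bakry–Émery's `(G₂)`) FOR LIPSCHITZ OBSERVABLES of the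
# `SU(2)` lattice Langevin dynamics, with LOCAL Lipschitz data, uniformly in the volume

Seat `ym-line-csu-p1` (g42), route `ColdStartUniversality` of `Summits/QuantumFields/YangMills`, helper file G63c (`--supports stmt-QuantumFields-24809`).
g29 proved the pointwise gradient bound `Γ^A(κ_t F)(x) ≤ e^(−2(1−12|β'|)t)·κ_t(Γ^A F)(x)` for `C⁵` CYLINDER observables (`wilson_carre_transition_le_uniform`).
Kuwada's duality (the `W₂` form of Shen–Zhu–Zhu's Theorem 4.2, sequel files) needs it for the Hopf–Lax functions `Q_s g`, which are only Lipschitz,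
with the LOCAL slope in place of `|∇F|`.  This file proves exactly that: if `F` is `ρ_L`-Lipschitz and, on every `ρ_L`-ball of a fixed radius `R`,
Lipschitz with constant `G(centre)` (`G` bounded measurable), then for all `x, x'`
`|κ_t F(x') − κ_t F(x)| ≤ e^(−(1−12|β'|)t)·√S·ρ_L(x,x')` whenever `κ_t(G²) ≤ S` on the ball `{ρ_L(x,·) ≤ ρ_L(x,x')}` — by mollifying `F` (quaternionic-
retraction extension + normed bump, G52–G54) with the localised tools of G63a/G63b:

* ★★ `exists_smooth_approx_local_carre` — `C⁵` `g_r` with `|g_r∘coords − F| ≤ 12·L_F·√#E·r` and `Γ^A(g_r)(w) ≤ 2(G(w)/(1−2r))²` at every `w`;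
* ★★ `wilson_lipschitz_of_local_carre` — `Γ^A(g) ≤ 2(G/(1−2r))²` pointwise ⇒ `|κ_t(g∘coords)(x') − κ_t(g∘coords)(x)| ≤ e^(−ct)·√S/(1−2r)·ρ_L(x,x')`;
* ★★★ `wilson_local_gradient_bound` — the `(G₂)` bound for Lipschitz observables with local data, as displayed above.

THEOREMS ONLY, no definition, no sorry.  HONEST FRAMING: fixed cut-off, `|β'| < 1/12`; "uniform" = in `L`; nothing `K`-uniform along the route's
scaling; `UniformColdStartMixing` (24809, ASIDE) is not restated; no crux, rung or summit statement is proved; the Yang–Mills mass gap is NOT proved.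
-/

set_option autoImplicit false

noncomputable section

namespace Summit.QuantumFields.YangMills.Theorems.ColdStartUniversality

open MeasureTheory ProbabilityTheory Matrix Complex Finset Filter Topology Set Metric
open scoped ComplexConjugate BigOperators Real NNReal Convolution
open Literature.MathematicalPhysics.QuantumFieldTheory
open Literature.MathematicalPhysics.QuantumLattice (fundamentalRep fundamentalLatticeRep continuous_fundamentalRep fundamentalRep_apply fundamentalLatticeRep_N)

variable {L : ℕ} [NeZero L]

/-! ## §4. The `(G₂)` gradient bound for Lipschitz observables with local data -/

/-- ★★ **Smooth approximation with LOCAL control of the carré du champ.**  For `F` `L_F`-Lipschitz in `ρ_L` and `G(w)`-Lipschitz on each ball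
`{ρ_L(w,·) ≤ R}` (`G ≥ 0`), and `0 < r ≤ 1/4` with `12√#E·r < R`, the mollification `g_r = φ_r ⋆ F̃` is `C⁵` with `|g_r∘coords − F| ≤ 12·L_F·√#E·r`
and `Γ^A(g_r)(w) ≤ 2·(G(w)/(1−2r))²` at EVERY `w` (§2 + §3). [cite: BakryGentilLedoux2014, Thm 3.2.3 / (3.2.4)] -/
theorem exists_smooth_approx_local_carre (β' : ℝ) {F : GaugeConfig 3 L (Matrix.specialUnitaryGroup (Fin 2) ℂ) → ℝ} {Lf : ℝ} (hLf : 0 ≤ Lf)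
    (hlip : ∀ Q Q', |F Q' - F Q| ≤ Lf * Real.sqrt (torusRiemannDistSq (fundamentalLatticeRep 2) Q Q'))
    {R : ℝ} {G : GaugeConfig 3 L (Matrix.specialUnitaryGroup (Fin 2) ℂ) → ℝ} (hG0 : ∀ w, 0 ≤ G w)
    (hloc : ∀ w z' z'' : GaugeConfig 3 L (Matrix.specialUnitaryGroup (Fin 2) ℂ),
      Real.sqrt (torusRiemannDistSq (fundamentalLatticeRep 2) w z') ≤ R → Real.sqrt (torusRiemannDistSq (fundamentalLatticeRep 2) w z'') ≤ R →
        |F z'' - F z'| ≤ G w * Real.sqrt (torusRiemannDistSq (fundamentalLatticeRep 2) z' z''))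
    {r : ℝ} (hr0 : 0 < r) (hr : r ≤ 1 / 4) (hrR : 12 * Real.sqrt (Fintype.card (Edge 3 L)) * r < R) :
    let coords : GaugeConfig 3 L (Matrix.specialUnitaryGroup (Fin 2) ℂ) → (Edge 3 L × Fin 2 × Fin 2 × Bool → ℝ) :=
      fun V q => (fun z : ℂ => if q.2.2.2 then z.im else z.re)
        ((fundamentalRep (Fin 2) (V q.1) : Matrix (Fin 2) (Fin 2) ℂ) q.2.1 q.2.2.1)
    let A : GaugeConfig 3 L (Matrix.specialUnitaryGroup (Fin 2) ℂ) → (Edge 3 L × Fin 2 × Fin 2 × Bool) →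
        (Edge 3 L × Fin 2 × Fin 2 × Bool) → ℝ := fun V i j =>
      ∑ n : Edge 3 L × NoiseIdx 2,
        (if n.1 = i.1 then (fun z : ℂ => if i.2.2.2 then z.im else z.re)
          ((latticeLangevinDynamics (fundamentalLatticeRep 2) β').noise
            (matrixConfig (fundamentalRep (Fin 2)) V) i.1 n.2 i.2.1 i.2.2.1) else 0) *
        (if n.1 = j.1 then (fun z : ℂ => if j.2.2.2 then z.im else z.re)
          ((latticeLangevinDynamics (fundamentalLatticeRep 2) β').noise
            (matrixConfig (fundamentalRep (Fin 2)) V) j.1 n.2 j.2.1 j.2.2.1) else 0)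
    ∃ g : (Edge 3 L × Fin 2 × Fin 2 × Bool → ℝ) → ℝ, ContDiff ℝ 5 g ∧
      (∀ P : GaugeConfig 3 L (Matrix.specialUnitaryGroup (Fin 2) ℂ), |g (coords P) - F P| ≤ Lf * (12 * Real.sqrt (Fintype.card (Edge 3 L)) * r)) ∧
      ∀ w : GaugeConfig 3 L (Matrix.specialUnitaryGroup (Fin 2) ℂ),
        (∑ i : Edge 3 L × Fin 2 × Fin 2 × Bool, ∑ j : Edge 3 L × Fin 2 × Fin 2 × Bool,
          fderiv ℝ g (coords w) (Pi.single i 1) * fderiv ℝ g (coords w) (Pi.single j 1) * A w i j) ≤ 2 * (G w / (1 - 2 * r)) ^ 2 := by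
  intro coords A
  let rebuild : (Edge 3 L × Fin 2 × Fin 2 × Bool → ℝ) → Edge 3 L → Matrix (Fin 2) (Fin 2) ℂ :=
    fun x e => Matrix.of fun i j : Fin 2 => ((x (e, i, j, false) : ℝ) : ℂ) + ((x (e, i, j, true) : ℝ) : ℂ) * Complex.I
  let qP : Matrix (Fin 2) (Fin 2) ℂ → Matrix (Fin 2) (Fin 2) ℂ := fun M =>
    !![(M 0 0 + conj (M 1 1)) / 2, (M 0 1 - conj (M 1 0)) / 2; -conj ((M 0 1 - conj (M 1 0)) / 2), conj ((M 0 0 + conj (M 1 1)) / 2)]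
  let retr : (Edge 3 L × Fin 2 × Fin 2 × Bool → ℝ) → GaugeConfig 3 L (Matrix.specialUnitaryGroup (Fin 2) ℂ) := fun x e =>
    if h : hsForm 2 (qP (rebuild x e)) (qP (rebuild x e)) ≠ 0 then
      ⟨(Real.sqrt 2 / Real.sqrt (hsForm 2 (qP (rebuild x e)) (qP (rebuild x e)))) • qP (rebuild x e),
        normalize_quatProj_mem_specialUnitaryGroup_two (rebuild x e) h⟩
    else 1
  let cut : (Edge 3 L × Fin 2 × Fin 2 × Bool → ℝ) → ℝ := fun x =>
    ∏ e : Edge 3 L, Real.smoothTransition (8 * hsForm 2 (qP (rebuild x e)) (qP (rebuild x e)) - 1)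
  classical
  haveI := borelSpace_config L
  have hFc : Continuous F := continuous_of_riemannLipschitz hlip
  have h12 : 0 < 1 - 2 * r := by linarith
  let Ft : (Edge 3 L × Fin 2 × Fin 2 × Bool → ℝ) → ℝ := fun x => cut x * F (retr x)
  have hFt : Continuous Ft := continuous_ext F hFc
  let φ : ContDiffBump (0 : Edge 3 L × Fin 2 × Fin 2 × Bool → ℝ) := ⟨r / 2, r, half_pos hr0, half_lt_self hr0⟩
  let g : (Edge 3 L × Fin 2 × Fin 2 × Bool → ℝ) → ℝ := φ.normed volume ⋆[ContinuousLinearMap.lsmul ℝ ℝ, volume] Ft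
  have hg : ContDiff ℝ 5 g := φ.hasCompactSupport_normed.contDiff_convolution_left _ φ.contDiff_normed hFt.locallyIntegrable
  refine ⟨g, hg, fun P => ?_, fun w => ?_⟩
  · have hP : Ft (coords P) = F P := (ext_coords F P).2
    have h1 : dist (g (coords P)) (Ft (coords P)) ≤ Lf * (12 * Real.sqrt (Fintype.card (Edge 3 L)) * r) := by
      refine φ.dist_normed_convolution_le hFt.aestronglyMeasurable fun y hy => ?_
      have hy' : ‖y - coords P‖ ≤ r := by
        have h := (Metric.mem_ball.1 hy).le
        rwa [dist_eq_norm] at h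
      have hmod : |cut y * F (retr y) - F P| ≤ Lf * (12 * Real.sqrt (Fintype.card (Edge 3 L)) * r) := ext_modulus F hLf hlip P y hr hy'
      rw [Real.dist_eq, hP]
      exact hmod
    rw [Real.dist_eq, hP] at h1
    exact h1
  · -- `Γ^A(g)(w) ≤ 2(G(w)/(1−2r) + η)²` for every `η > 0`
    have hη : ∀ η : ℝ, 0 < η → (∑ i : Edge 3 L × Fin 2 × Fin 2 × Bool, ∑ j : Edge 3 L × Fin 2 × Fin 2 × Bool,
        fderiv ℝ g (coords w) (Pi.single i 1) * fderiv ℝ g (coords w) (Pi.single j 1) * A w i j) ≤ 2 * (G w / (1 - 2 * r) + η) ^ 2 := by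
      intro η hη
      obtain ⟨δ, hδ, hloc'⟩ : ∃ δ > 0, ∀ s : Edge 3 L × Fin 2 × Fin 2 × Bool → ℝ, ‖s‖ ≤ r → ∀ Q' : GaugeConfig 3 L (Matrix.specialUnitaryGroup (Fin 2) ℂ),
          Real.sqrt (torusRiemannDistSq (fundamentalLatticeRep 2) w Q') < δ →
            |Ft (coords Q' - s) - Ft (coords w - s)| ≤ (G w / (1 - 2 * r) + η) * Real.sqrt (torusRiemannDistSq (fundamentalLatticeRep 2) w Q') :=
        ext_shift_localLipschitz_at F w (hG0 w) (hloc w) hr hrR hη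
      have hgloc : ∃ δ > 0, ∀ Q' : GaugeConfig 3 L (Matrix.specialUnitaryGroup (Fin 2) ℂ), Real.sqrt (torusRiemannDistSq (fundamentalLatticeRep 2) w Q') < δ →
          |g (coords Q') - g (coords w)| ≤ (G w / (1 - 2 * r) + η) * Real.sqrt (torusRiemannDistSq (fundamentalLatticeRep 2) w Q') := by
        refine ⟨δ, hδ, fun Q' hQ' => ?_⟩
        exact normed_convolution_sub_le volume φ hFt (coords Q') (coords w)
          (B := (G w / (1 - 2 * r) + η) * Real.sqrt (torusRiemannDistSq (fundamentalLatticeRep 2) w Q'))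
          (fun s hs => hloc' s (mem_ball_zero_iff.1 hs).le Q' hQ')
      have hpos : 0 ≤ G w / (1 - 2 * r) + η := add_nonneg (div_nonneg (hG0 w) h12.le) hη.le
      exact carre_le_two_mul_sq_of_local_riemannLipschitz w β' (hg.differentiable (by norm_num)) hpos hgloc
    -- `η → 0`
    refine le_of_forall_pos_le_add fun ε' hε' => ?_
    have ha0 : 0 ≤ G w / (1 - 2 * r) := div_nonneg (hG0 w) h12.le
    obtain ⟨a, ha⟩ : ∃ a : ℝ, a = G w / (1 - 2 * r) := ⟨_, rfl⟩
    rw [← ha] at hη ha0 ⊢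
    have hη0 : 0 < min 1 (ε' / (2 * (2 * a + 1))) := lt_min one_pos (div_pos hε' (by positivity))
    have hη1 : min 1 (ε' / (2 * (2 * a + 1))) ≤ 1 := min_le_left _ _
    have hη2 : min 1 (ε' / (2 * (2 * a + 1))) * (2 * (2 * a + 1)) ≤ ε' := by
      have := min_le_right (1 : ℝ) (ε' / (2 * (2 * a + 1)))
      rwa [le_div_iff₀ (by positivity)] at this
    have h := hη _ hη0
    have hexp : 2 * (a + min 1 (ε' / (2 * (2 * a + 1)))) ^ 2 =
        2 * a ^ 2 + min 1 (ε' / (2 * (2 * a + 1))) * (2 * (2 * a + min 1 (ε' / (2 * (2 * a + 1))))) := by ring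
    have hmono : min 1 (ε' / (2 * (2 * a + 1))) * (2 * (2 * a + min 1 (ε' / (2 * (2 * a + 1))))) ≤
        min 1 (ε' / (2 * (2 * a + 1))) * (2 * (2 * a + 1)) := mul_le_mul_of_nonneg_left (by linarith) hη0.le
    linarith

/-- ★★ **From local carré-du-champ data to a Lipschitz bound for `κ_t`.**  For `|β'| < 1/12`, a realising kernel family `κ`, a `C⁵` `g` with
`Γ^A(g)(w) ≤ 2(G(w)/(1−2r))²` everywhere (`G` measurable, `0 ≤ G ≤ M`, `r < 1/2`) and `∫G² dκ_t(z) ≤ S` on the ball `{ρ_L(x,z) ≤ ρ_L(x,x')}`: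
`|∫ g∘coords dκ_t(x') − ∫ g∘coords dκ_t(x)| ≤ e^(−(1−12|β'|)t)·√S/(1−2r)·ρ_L(x,x')` (g29's `(G₂)` bound + §1). [cite: BakryGentilLedoux2014, Thm 3.2.3 / (3.2.4)] -/
theorem wilson_lipschitz_of_local_carre (L : ℕ) [NeZero L] (β' : ℝ) (hβ : |β'| < 1 / 12)
    (κ : ℝ≥0 → Kernel (GaugeConfig 3 L (Matrix.specialUnitaryGroup (Fin 2) ℂ))
      (GaugeConfig 3 L (Matrix.specialUnitaryGroup (Fin 2) ℂ))) [∀ t, IsMarkovKernel (κ t)]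
    (hreal : ∀ (t : ℝ≥0) (x : GaugeConfig 3 L (Matrix.specialUnitaryGroup (Fin 2) ℂ))
        (Ω : Type) [MeasurableSpace Ω] (P : Measure Ω) [IsProbabilityMeasure P]
        (W : ℝ≥0 → Ω → (Edge 3 L × NoiseIdx 2 → ℝ)) (hW : IsFlatBrownian W P)
        (U : ℝ≥0 → Ω → GaugeConfig 3 L (Matrix.specialUnitaryGroup (Fin 2) ℂ)),
        (∀ ω, U 0 ω = x) →
        (latticeLangevinDynamics (fundamentalLatticeRep 2) β').IsSolution (fundamentalRep (Fin 2))
          hW.natFiltration P W U →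
        κ t x = P.map (U t))
    {g : (Edge 3 L × Fin 2 × Fin 2 × Bool → ℝ) → ℝ} (hg : ContDiff ℝ 5 g)
    {G : GaugeConfig 3 L (Matrix.specialUnitaryGroup (Fin 2) ℂ) → ℝ} (hGm : Measurable G) {M : ℝ} (hG0 : ∀ w, 0 ≤ G w) (hGM : ∀ w, G w ≤ M)
    {r : ℝ} (hr : r < 1 / 2) (t : ℝ≥0) (x x' : GaugeConfig 3 L (Matrix.specialUnitaryGroup (Fin 2) ℂ)) {S : ℝ}
    (hS : ∀ z : GaugeConfig 3 L (Matrix.specialUnitaryGroup (Fin 2) ℂ),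
      Real.sqrt (torusRiemannDistSq (fundamentalLatticeRep 2) x z) ≤ Real.sqrt (torusRiemannDistSq (fundamentalLatticeRep 2) x x') →
        ∫ y, G y ^ 2 ∂(κ t z) ≤ S) :
    let coords : GaugeConfig 3 L (Matrix.specialUnitaryGroup (Fin 2) ℂ) → (Edge 3 L × Fin 2 × Fin 2 × Bool → ℝ) :=
      fun V q => (fun z : ℂ => if q.2.2.2 then z.im else z.re)
        ((fundamentalRep (Fin 2) (V q.1) : Matrix (Fin 2) (Fin 2) ℂ) q.2.1 q.2.2.1)
    let A : GaugeConfig 3 L (Matrix.specialUnitaryGroup (Fin 2) ℂ) → (Edge 3 L × Fin 2 × Fin 2 × Bool) →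
        (Edge 3 L × Fin 2 × Fin 2 × Bool) → ℝ := fun V i j =>
      ∑ n : Edge 3 L × NoiseIdx 2,
        (if n.1 = i.1 then (fun z : ℂ => if i.2.2.2 then z.im else z.re)
          ((latticeLangevinDynamics (fundamentalLatticeRep 2) β').noise
            (matrixConfig (fundamentalRep (Fin 2)) V) i.1 n.2 i.2.1 i.2.2.1) else 0) *
        (if n.1 = j.1 then (fun z : ℂ => if j.2.2.2 then z.im else z.re)
          ((latticeLangevinDynamics (fundamentalLatticeRep 2) β').noise
            (matrixConfig (fundamentalRep (Fin 2)) V) j.1 n.2 j.2.1 j.2.2.1) else 0)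
    (∀ w : GaugeConfig 3 L (Matrix.specialUnitaryGroup (Fin 2) ℂ),
      (∑ i : Edge 3 L × Fin 2 × Fin 2 × Bool, ∑ j : Edge 3 L × Fin 2 × Fin 2 × Bool,
        fderiv ℝ g (coords w) (Pi.single i 1) * fderiv ℝ g (coords w) (Pi.single j 1) * A w i j) ≤ 2 * (G w / (1 - 2 * r)) ^ 2) →
    |∫ y, g (coords y) ∂(κ t x') - ∫ y, g (coords y) ∂(κ t x)| ≤
      Real.exp (-((1 - 12 * |β'|) * (t : ℝ))) * Real.sqrt S / (1 - 2 * r) * Real.sqrt (torusRiemannDistSq (fundamentalLatticeRep 2) x x') := by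
  intro coords A hcarre
  classical
  haveI := borelSpace_config L
  have h12 : 0 < 1 - 2 * r := by linarith
  have hS0 : 0 ≤ S := by
    have h := hS x (by rw [torusRiemannDistSq_self, Real.sqrt_zero]; exact Real.sqrt_nonneg _)
    exact le_trans (integral_nonneg fun y => sq_nonneg (G y)) h
  -- g29's gradient bound for `g`
  obtain ⟨gt, hgt, -, hrep, hgrad⟩ := wilson_carre_transition_le_uniform L β' hβ κ hreal hg t
  have hσ : ∀ z : GaugeConfig 3 L (Matrix.specialUnitaryGroup (Fin 2) ℂ),
      torusRiemannDistSq (fundamentalLatticeRep 2) x z ≤ torusRiemannDistSq (fundamentalLatticeRep 2) x x' →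
      (∑ i : Edge 3 L × Fin 2 × Fin 2 × Bool, ∑ j : Edge 3 L × Fin 2 × Fin 2 × Bool,
        fderiv ℝ gt (coords z) (Pi.single i 1) * fderiv ℝ gt (coords z) (Pi.single j 1) * A z i j) ≤
          (2 / (1 - 2 * r) ^ 2 * S) / Real.exp (2 * (1 - 12 * |β'|) * (t : ℝ)) := by
    intro z hz
    haveI : IsProbabilityMeasure (κ t z) := IsMarkovKernel.isProbabilityMeasure z
    have h1 := hgrad z
    have hSz : ∫ y, G y ^ 2 ∂(κ t z) ≤ S := hS z (Real.sqrt_le_sqrt hz)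
    have hnn : ∀ y : GaugeConfig 3 L (Matrix.specialUnitaryGroup (Fin 2) ℂ), 0 ≤ (∑ i : Edge 3 L × Fin 2 × Fin 2 × Bool, ∑ j : Edge 3 L × Fin 2 × Fin 2 × Bool,
        fderiv ℝ g (coords y) (Pi.single i 1) * fderiv ℝ g (coords y) (Pi.single j 1) * A y i j) := by
      intro y
      have heq : (∑ i : Edge 3 L × Fin 2 × Fin 2 × Bool, ∑ j : Edge 3 L × Fin 2 × Fin 2 × Bool,
          fderiv ℝ g (coords y) (Pi.single i 1) * fderiv ℝ g (coords y) (Pi.single j 1) * A y i j) =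
          ∑ n : Edge 3 L × NoiseIdx (fundamentalLatticeRep 2).N, (fderiv ℝ g (coords y) (fun q : Edge 3 L × Fin (fundamentalLatticeRep 2).N × Fin (fundamentalLatticeRep 2).N × Bool =>
            if n.1 = q.1 then (fun z : ℂ => if q.2.2.2 then z.im else z.re) (((Real.sqrt 2 : ℂ) • ((fundamentalLatticeRep 2).lieProj (noiseDir n.2) *
              (fundamentalLatticeRep 2).ρ (y q.1))) q.2.1 q.2.2.1) else 0)) ^ 2 := carre_eq_sum_sq_frame_two β' g y
      rw [heq]; exact Finset.sum_nonneg fun n _ => sq_nonneg _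
    have hGi : Integrable (fun y => 2 * (G y / (1 - 2 * r)) ^ 2) (κ t z) := by
      have hb : ∀ y, 2 * (G y / (1 - 2 * r)) ^ 2 ∈ Set.Icc (0 : ℝ) (2 * (M / (1 - 2 * r)) ^ 2) := fun y =>
        ⟨by positivity, by
          have := div_le_div_of_nonneg_right (hGM y) h12.le
          have h0 : 0 ≤ G y / (1 - 2 * r) := div_nonneg (hG0 y) h12.le
          nlinarith⟩
      have hmeas : Measurable fun y => 2 * (G y / (1 - 2 * r)) ^ 2 := ((hGm.div_const _).pow_const 2).const_mul 2
      exact (memLp_of_bounded (ae_of_all _ hb) hmeas.aestronglyMeasurable 1).integrable le_rfl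
    have h2 : ∫ y, (∑ i : Edge 3 L × Fin 2 × Fin 2 × Bool, ∑ j : Edge 3 L × Fin 2 × Fin 2 × Bool,
        fderiv ℝ g (coords y) (Pi.single i 1) * fderiv ℝ g (coords y) (Pi.single j 1) * A y i j) ∂(κ t z) ≤ ∫ y, 2 * (G y / (1 - 2 * r)) ^ 2 ∂(κ t z) :=
      integral_mono_of_nonneg (ae_of_all _ hnn) hGi (ae_of_all _ hcarre)
    have h3 : ∫ y, 2 * (G y / (1 - 2 * r)) ^ 2 ∂(κ t z) = 2 / (1 - 2 * r) ^ 2 * ∫ y, G y ^ 2 ∂(κ t z) := by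
      rw [← integral_const_mul]
      refine integral_congr_ae (ae_of_all _ fun y => ?_)
      show 2 * (G y / (1 - 2 * r)) ^ 2 = 2 / (1 - 2 * r) ^ 2 * G y ^ 2
      field_simp
    have h4 : ∫ y, 2 * (G y / (1 - 2 * r)) ^ 2 ∂(κ t z) ≤ 2 / (1 - 2 * r) ^ 2 * S := by
      rw [h3]; exact mul_le_mul_of_nonneg_left hSz (by positivity)
    have hexp0 : 0 < Real.exp (2 * (1 - 12 * |β'|) * (t : ℝ)) := Real.exp_pos _
    rw [le_div_iff₀ hexp0, mul_comm]
    exact h1.trans (h2.trans h4)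
  -- the localised G42 for `gt`
  have hgt_lip : |gt (coords x') - gt (coords x)| ≤ Real.sqrt ((2 / (1 - 2 * r) ^ 2 * S) / Real.exp (2 * (1 - 12 * |β'|) * (t : ℝ)) / 2) *
      Real.sqrt (torusRiemannDistSq (fundamentalLatticeRep 2) x x') :=
    abs_sub_le_of_carre_le_on_ball L x x' β' (hgt.differentiable (by norm_num)) hσ
  have hsqrt : Real.sqrt ((2 / (1 - 2 * r) ^ 2 * S) / Real.exp (2 * (1 - 12 * |β'|) * (t : ℝ)) / 2) =
      Real.exp (-((1 - 12 * |β'|) * (t : ℝ))) * Real.sqrt S / (1 - 2 * r) := by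
    have he : Real.exp (2 * (1 - 12 * |β'|) * (t : ℝ)) = (Real.exp ((1 - 12 * |β'|) * (t : ℝ))) ^ 2 := by
      rw [← Real.exp_nat_mul]; congr 1; push_cast; ring
    have hE : 0 < Real.exp ((1 - 12 * |β'|) * (t : ℝ)) := Real.exp_pos _
    rw [he, show (2 / (1 - 2 * r) ^ 2 * S) / (Real.exp ((1 - 12 * |β'|) * (t : ℝ))) ^ 2 / 2 =
      (1 / ((1 - 2 * r) * Real.exp ((1 - 12 * |β'|) * (t : ℝ)))) ^ 2 * S by field_simp]
    rw [Real.sqrt_mul (sq_nonneg _), Real.sqrt_sq (by positivity), Real.exp_neg]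
    field_simp
  rw [hrep x', hrep x, ← hsqrt]
  exact hgt_lip

/-- ★★★ **Pointwise `L²` gradient bound for Lipschitz observables, with local Lipschitz data.**  Let `|β'| < 1/12`, `κ` a realising kernel family,
`F : SU(2)^E → ℝ` `L_F`-Lipschitz for `ρ_L`, and `G` measurable with `0 ≤ G ≤ M` such that `F` is `G(w)`-Lipschitz on every ball `{ρ_L(w,·) ≤ R}` (a
fixed `R > 0`).  If `∫ G² dκ_t(z) ≤ S` for all `z` with `ρ_L(x,z) ≤ ρ_L(x,x')`, then
`|∫F dκ_t(x') − ∫F dκ_t(x)| ≤ e^(−(1−12|β'|)t)·√S·ρ_L(x,x')` — Bakry–Émery's `(G₂)` `|∇P_tF| ≤ e^(−ct)(P_t|∇F|²)^{1/2}` in integrated form, with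
`|∇F|` replaced by any local Lipschitz majorant. [cite: BakryGentilLedoux2014, Thm 3.2.3 / (3.2.4)] -/
theorem wilson_local_gradient_bound (L : ℕ) [NeZero L] (β' : ℝ) (hβ : |β'| < 1 / 12)
    (κ : ℝ≥0 → Kernel (GaugeConfig 3 L (Matrix.specialUnitaryGroup (Fin 2) ℂ))
      (GaugeConfig 3 L (Matrix.specialUnitaryGroup (Fin 2) ℂ))) [∀ t, IsMarkovKernel (κ t)]
    (hreal : ∀ (t : ℝ≥0) (x : GaugeConfig 3 L (Matrix.specialUnitaryGroup (Fin 2) ℂ))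
        (Ω : Type) [MeasurableSpace Ω] (P : Measure Ω) [IsProbabilityMeasure P]
        (W : ℝ≥0 → Ω → (Edge 3 L × NoiseIdx 2 → ℝ)) (hW : IsFlatBrownian W P)
        (U : ℝ≥0 → Ω → GaugeConfig 3 L (Matrix.specialUnitaryGroup (Fin 2) ℂ)),
        (∀ ω, U 0 ω = x) →
        (latticeLangevinDynamics (fundamentalLatticeRep 2) β').IsSolution (fundamentalRep (Fin 2))
          hW.natFiltration P W U →
        κ t x = P.map (U t))
    {F : GaugeConfig 3 L (Matrix.specialUnitaryGroup (Fin 2) ℂ) → ℝ} {Lf : ℝ} (hLf : 0 ≤ Lf)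
    (hlip : ∀ Q Q', |F Q' - F Q| ≤ Lf * Real.sqrt (torusRiemannDistSq (fundamentalLatticeRep 2) Q Q'))
    {R : ℝ} (hR : 0 < R) {G : GaugeConfig 3 L (Matrix.specialUnitaryGroup (Fin 2) ℂ) → ℝ} (hGm : Measurable G) {M : ℝ}
    (hG0 : ∀ w, 0 ≤ G w) (hGM : ∀ w, G w ≤ M)
    (hloc : ∀ w z' z'' : GaugeConfig 3 L (Matrix.specialUnitaryGroup (Fin 2) ℂ),
      Real.sqrt (torusRiemannDistSq (fundamentalLatticeRep 2) w z') ≤ R → Real.sqrt (torusRiemannDistSq (fundamentalLatticeRep 2) w z'') ≤ R →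
        |F z'' - F z'| ≤ G w * Real.sqrt (torusRiemannDistSq (fundamentalLatticeRep 2) z' z''))
    (t : ℝ≥0) (x x' : GaugeConfig 3 L (Matrix.specialUnitaryGroup (Fin 2) ℂ)) {S : ℝ}
    (hS : ∀ z : GaugeConfig 3 L (Matrix.specialUnitaryGroup (Fin 2) ℂ),
      Real.sqrt (torusRiemannDistSq (fundamentalLatticeRep 2) x z) ≤ Real.sqrt (torusRiemannDistSq (fundamentalLatticeRep 2) x x') →
        ∫ y, G y ^ 2 ∂(κ t z) ≤ S) :
    |∫ y, F y ∂(κ t x') - ∫ y, F y ∂(κ t x)| ≤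
      Real.exp (-((1 - 12 * |β'|) * (t : ℝ))) * Real.sqrt S * Real.sqrt (torusRiemannDistSq (fundamentalLatticeRep 2) x x') := by
  let coords : GaugeConfig 3 L (Matrix.specialUnitaryGroup (Fin 2) ℂ) → (Edge 3 L × Fin 2 × Fin 2 × Bool → ℝ) :=
    fun V q => (fun z : ℂ => if q.2.2.2 then z.im else z.re) ((fundamentalRep (Fin 2) (V q.1) : Matrix (Fin 2) (Fin 2) ℂ) q.2.1 q.2.2.1)
  classical
  haveI := borelSpace_config L
  have hFc : Continuous F := continuous_of_riemannLipschitz hlip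
  have hco : Continuous coords := continuous_coords (L := L)
  obtain ⟨E, hEdef⟩ : ∃ E : ℝ, E = Real.sqrt (Fintype.card (Edge 3 L)) := ⟨_, rfl⟩
  have hE0 : 0 ≤ E := by rw [hEdef]; exact Real.sqrt_nonneg _
  obtain ⟨D, hDdef⟩ : ∃ D : ℝ, D = Real.sqrt (torusRiemannDistSq (fundamentalLatticeRep 2) x x') := ⟨_, rfl⟩
  have hD0 : 0 ≤ D := by rw [hDdef]; exact Real.sqrt_nonneg _
  obtain ⟨c, hcdef⟩ : ∃ c : ℝ, c = Real.exp (-((1 - 12 * |β'|) * (t : ℝ))) := ⟨_, rfl⟩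
  have hc0 : 0 < c := by rw [hcdef]; exact Real.exp_pos _
  have hS0 : 0 ≤ S := by
    have h := hS x (by rw [torusRiemannDistSq_self, Real.sqrt_zero]; exact Real.sqrt_nonneg _)
    exact le_trans (integral_nonneg fun y => sq_nonneg (G y)) h
  rw [← hDdef, ← hcdef]
  refine le_of_forall_pos_le_add fun ε hε => ?_
  -- choice of the mollification radius
  obtain ⟨B, hBdef⟩ : ∃ B : ℝ, B = 24 * Lf * E + 4 * (c * Real.sqrt S * D) + 1 := ⟨_, rfl⟩
  have hB : 0 < B := by rw [hBdef]; positivity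
  obtain ⟨r, hrdef⟩ : ∃ r : ℝ, r = min (min (1 / 4) (R / (24 * E + 1))) (ε / B) := ⟨_, rfl⟩
  have hr0 : 0 < r := by rw [hrdef]; exact lt_min (lt_min (by norm_num) (div_pos hR (by positivity))) (div_pos hε hB)
  have hr : r ≤ 1 / 4 := by rw [hrdef]; exact (min_le_left _ _).trans (min_le_left _ _)
  have hrR : 12 * Real.sqrt (Fintype.card (Edge 3 L)) * r < R := by
    rw [← hEdef]
    have h1 : r ≤ R / (24 * E + 1) := by rw [hrdef]; exact (min_le_left _ _).trans (min_le_right _ _)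
    have h2 : 12 * E * r ≤ 12 * E * (R / (24 * E + 1)) := mul_le_mul_of_nonneg_left h1 (by positivity)
    have h3 : 12 * E * (R / (24 * E + 1)) < R := by
      rw [mul_div_assoc', div_lt_iff₀ (by positivity)]; nlinarith
    linarith
  have hrB : r * B ≤ ε := by
    have : r ≤ ε / B := by rw [hrdef]; exact min_le_right _ _
    rwa [le_div_iff₀ hB] at this
  have h12 : 0 < 1 - 2 * r := by linarith
  -- the smooth approximation with local carré control, and its Lipschitz bound under `κ_t`
  obtain ⟨g, hg, happrox', hcarre⟩ := exists_smooth_approx_local_carre (L := L) β' hLf hlip hG0 hloc hr0 hr hrR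
  have happrox : ∀ P : GaugeConfig 3 L (Matrix.specialUnitaryGroup (Fin 2) ℂ), |g (coords P) - F P| ≤ Lf * (12 * E * r) := by
    rw [hEdef]; exact happrox'
  have hglip : |∫ y, g (coords y) ∂(κ t x') - ∫ y, g (coords y) ∂(κ t x)| ≤ c * Real.sqrt S / (1 - 2 * r) * D := by
    rw [hcdef, hDdef]
    exact wilson_lipschitz_of_local_carre L β' hβ κ hreal hg hGm hG0 hGM (by linarith) t x x' hS hcarre
  -- `|∫F dκ − ∫g∘coords dκ| ≤ 12·L_F·E·r` at both points
  have hint : ∀ P : GaugeConfig 3 L (Matrix.specialUnitaryGroup (Fin 2) ℂ),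
      |∫ y, F y ∂(κ t P) - ∫ y, g (coords y) ∂(κ t P)| ≤ Lf * (12 * E * r) := by
    intro P
    have hFi : Integrable F (κ t P) := hFc.integrable_of_hasCompactSupport (HasCompactSupport.of_compactSpace F)
    have hgi : Integrable (fun y => g (coords y)) (κ t P) :=
      (hg.continuous.comp hco).integrable_of_hasCompactSupport (HasCompactSupport.of_compactSpace _)
    rw [← integral_sub hFi hgi]
    calc |∫ y, (F y - g (coords y)) ∂(κ t P)| ≤ ∫ y, |F y - g (coords y)| ∂(κ t P) := abs_integral_le_integral_abs
      _ ≤ ∫ _y, Lf * (12 * E * r) ∂(κ t P) :=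
          integral_mono_of_nonneg (ae_of_all _ fun _ => abs_nonneg _) (integrable_const _)
            (ae_of_all _ fun y => (abs_sub_comm _ _).trans_le (happrox y))
      _ = Lf * (12 * E * r) := by rw [integral_const, probReal_univ, one_smul]
  have h1 := hint x
  have h2 := hint x'
  have h4 := abs_sub_le (∫ y, F y ∂(κ t x')) (∫ y, g (coords y) ∂(κ t x')) (∫ y, F y ∂(κ t x))
  have h5 := abs_sub_le (∫ y, g (coords y) ∂(κ t x')) (∫ y, g (coords y) ∂(κ t x)) (∫ y, F y ∂(κ t x))
  have h6 : |∫ y, g (coords y) ∂(κ t x) - ∫ y, F y ∂(κ t x)| ≤ Lf * (12 * E * r) := by rw [abs_sub_comm]; exact h1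
  -- `1/(1−2r) ≤ 1 + 4r`
  have hfrac : c * Real.sqrt S / (1 - 2 * r) ≤ c * Real.sqrt S * (1 + 4 * r) := by
    rw [div_le_iff₀ h12]
    have : 1 ≤ (1 + 4 * r) * (1 - 2 * r) := by nlinarith
    have hcs : 0 ≤ c * Real.sqrt S := by positivity
    nlinarith
  calc |∫ y, F y ∂(κ t x') - ∫ y, F y ∂(κ t x)| ≤ Lf * (12 * E * r) + (c * Real.sqrt S / (1 - 2 * r) * D + Lf * (12 * E * r)) := by linarith
    _ ≤ Lf * (12 * E * r) + (c * Real.sqrt S * (1 + 4 * r) * D + Lf * (12 * E * r)) := by gcongr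
    _ = c * Real.sqrt S * D + r * (24 * Lf * E + 4 * (c * Real.sqrt S * D)) := by ring
    _ ≤ c * Real.sqrt S * D + r * B := by
        have : 24 * Lf * E + 4 * (c * Real.sqrt S * D) ≤ B := by rw [hBdef]; linarith
        nlinarith
    _ ≤ c * Real.sqrt S * D + ε := by linarith

end Summit.QuantumFields.YangMills.Theorems.ColdStartUniversality

end
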